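import Summits.AnomalousDissipation.AnomalousDissipation.Theorems.SolenoidalFractalHomogenisationLagrangianStepFlatBilinearSlow
import HarnessLib

/-!
# K1L_D (stmt-AnomalousDissipation-27980), §9z glue v2: the TEMPLATE FACTS of a carrier level feeding the bookkeeping
# (helper; `--supports … --as helper`; lead-k1l-onelevel-p1 g5; memo L12 §3(a)(d))

For a template carrier `E` (the hypotheses (T1)–(T5) of the registered texts) at level `m+1`, with `ρ = N m / N (m+1)`, `ν = cellVisc (m+1)`,
`n = N (m+1)`: the real-arithmetic consequences the glue `cellInputs_BIL_of` consumes —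
* `rho_facts` — `0 < ρ ≤ 1`, `ρ·Λ₀ ≤ 1`;
* `nu_le_rpow` — (T2) ⇒ `ν ≤ ρ^{1/4}`;
* `ceil_facts` — (T3) + `K ≤ E.K` + `ρ ≤ 1/16` (separation `Λ₀ ≥ 16`) ⇒ `⌈K/ν⌉ ≤ n` and `⌈K/ν⌉/n ≤ 2ρ^{1/4}` (resolution side condition and error term of (V_modEC));
* `theta_facts` — (T4) ⇒ `θ(m+1) ≤ θ₀` and `θ(m+1) ≤ θ₀·ρ^{1/16}`;
* `period_facts` — (T5) + `physPeriod_eq` ⇒ `(M·Wp/ν)/(a·τ) = physPeriod/τ` and `physPeriod ≤ ρ^{1/16}·R`.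
Pure bookkeeping; NOT a proof of any registered stub, of the crux, or of AD; rung F-D1.A0.
-/

set_option linter.dupNamespace false  -- the summit-side namespace `Summit.AnomalousDissipation.AnomalousDissipation.…` repeats a component by design (D-0017)

noncomputable section

namespace Summit.AnomalousDissipation.AnomalousDissipation.Theorems.SolenoidalFractalHomogenisation.LagrangianStep.Z7Glue

open Literature.Analysis Literature.Analysis.FluidPDE Literature.Analysis.FunctionSpaces
open Literature.Analysis.FluidPDE.LatticeShear (LagrangianLatticeCarrier LatticeWord)
open Summit.AnomalousDissipation.AnomalousDissipation.Theorems.SolenoidalFractalHomogenisation.LagrangianRenormalisationStep (cellVisc_pos')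

variable {k : ℕ}

/-- `0 < ρ ≤ 1` and `ρ·Λ₀ ≤ 1` for `ρ = N m / N (m+1)` under lacunarity `N m² ≤ N (m+1)` and separation `Λ₀ N m ≤ N (m+1)`. -/
theorem rho_facts (E : LagrangianLatticeCarrier k) (m : ℕ) {Λ₀ : ℕ} (hT1 : Λ₀ * E.N m ≤ E.N (m + 1)) (hN2 : E.N m ^ 2 ≤ E.N (m + 1)) :
    0 < (E.N m : ℝ) / E.N (m + 1) ∧ (E.N m : ℝ) / E.N (m + 1) ≤ 1 ∧ (E.N m : ℝ) / E.N (m + 1) * Λ₀ ≤ 1 := by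
  have hN : (0:ℝ) < E.N (m + 1) := by exact_mod_cast E.N_pos (m + 1)
  have hNm : (0:ℝ) < E.N m := by exact_mod_cast E.N_pos m
  refine ⟨div_pos hNm hN, OneLevelSplit.rho_le_one hN2, ?_⟩
  have h' : ((Λ₀ : ℕ) : ℝ) * (E.N m : ℝ) ≤ (E.N (m + 1) : ℝ) := by exact_mod_cast hT1
  rw [div_mul_eq_mul_div, div_le_one hN]
  linarith [mul_comm ((Λ₀ : ℕ) : ℝ) (E.N m : ℝ)]

/-- (T2) ⇒ `ν ≤ ρ^{1/4}`. -/
theorem nu_le_rpow (E : LagrangianLatticeCarrier k) (m : ℕ)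
    (hT2 : E.cellVisc (m + 1) * ((E.N (m + 1) : ℝ) / E.N m) ^ (1 / 4 : ℝ) ≤ 1) :
    E.cellVisc (m + 1) ≤ ((E.N m : ℝ) / E.N (m + 1)) ^ (1 / 4 : ℝ) := by
  set ρ : ℝ := (E.N m : ℝ) / E.N (m + 1) with hρ_def
  have hN : (0:ℝ) < E.N (m + 1) := by exact_mod_cast E.N_pos (m + 1)
  have hNm : (0:ℝ) < E.N m := by exact_mod_cast E.N_pos m
  have hρ0 : 0 < ρ := div_pos hNm hN
  have e : ((E.N (m + 1) : ℝ) / E.N m) = ρ⁻¹ := by rw [hρ_def, inv_div]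
  rw [e, Real.inv_rpow hρ0.le] at hT2
  have hpos : 0 < ρ ^ (1 / 4 : ℝ) := Real.rpow_pos_of_pos hρ0 _
  calc E.cellVisc (m + 1) = E.cellVisc (m + 1) * (ρ ^ (1 / 4 : ℝ))⁻¹ * ρ ^ (1 / 4 : ℝ) := by field_simp
    _ ≤ 1 * ρ ^ (1 / 4 : ℝ) := mul_le_mul_of_nonneg_right hT2 hpos.le
    _ = ρ ^ (1 / 4 : ℝ) := one_mul _

/-- `16 ≤ x` ⇒ `2 ≤ x^{1/4}`. -/
theorem two_le_rpow_quarter {x : ℝ} (hx : 16 ≤ x) : 2 ≤ x ^ (1 / 4 : ℝ) := by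
  have hx0 : 0 ≤ x := by linarith
  have h16 : (16:ℝ) ^ (1 / 4 : ℝ) = 2 := by
    rw [show (16:ℝ) = 2 ^ (4:ℝ) by norm_num, ← Real.rpow_mul (by norm_num)]
    norm_num
  rw [← h16]
  exact Real.rpow_le_rpow (by norm_num) hx (by norm_num)

/-- (T3) + `K ≤ E.K` + `ρ ≤ 1/16` ⇒ the resolution side condition `⌈K/ν⌉ ≤ n` and the error-term bound `⌈K/ν⌉/n ≤ 2ρ^{1/4}`. -/
theorem ceil_facts (E : LagrangianLatticeCarrier k) (m : ℕ) {K : ℝ} (hK0 : 0 ≤ K) (hKE : K ≤ E.K)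
    (hρ16 : (E.N m : ℝ) / E.N (m + 1) ≤ 1 / 16)
    (hT3 : E.K * ((E.N (m + 1) : ℝ) / E.N m) ^ (1 / 4 : ℝ) ≤ ((E.N (m + 1) : ℝ) / E.N m) * E.cellVisc (m + 1)) :
    (⌈K / E.cellVisc (m + 1)⌉₊ : ℝ) ≤ E.N (m + 1) ∧
      (⌈K / E.cellVisc (m + 1)⌉₊ : ℝ) / E.N (m + 1) ≤ 2 * ((E.N m : ℝ) / E.N (m + 1)) ^ (1 / 4 : ℝ) := by
  set ν : ℝ := E.cellVisc (m + 1) with hν_def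
  set ρ : ℝ := (E.N m : ℝ) / E.N (m + 1) with hρ_def
  set ρ' : ℝ := (E.N (m + 1) : ℝ) / E.N m with hρ'_def
  have hν : 0 < ν := cellVisc_pos' E.toFractalCarrierData (m + 1)
  have hN : (0:ℝ) < E.N (m + 1) := by exact_mod_cast E.N_pos (m + 1)
  have hNm1 : (1:ℝ) ≤ E.N m := by exact_mod_cast E.N_pos m
  have hNm : (0:ℝ) < E.N m := by linarith
  have hρ0 : 0 < ρ := div_pos hNm hN
  have hρρ' : ρ' = ρ⁻¹ := by rw [hρ_def, hρ'_def, inv_div]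
  have hρ'16 : 16 ≤ ρ' := by
    rw [hρρ']
    exact (le_inv_comm₀ (by norm_num) hρ0).mpr (by rw [← one_div]; exact hρ16)
  have hρ'0 : 0 < ρ' := by linarith
  -- `ρ'^{1/4} ≥ 2`, `ρ' = ρ'^{1/4} · ρ'^{3/4}`
  have hq2 : 2 ≤ ρ' ^ (1 / 4 : ℝ) := two_le_rpow_quarter hρ'16
  have hq0 : 0 < ρ' ^ (1 / 4 : ℝ) := by linarith
  have hsplit : ρ' = ρ' ^ (1 / 4 : ℝ) * ρ' ^ (3 / 4 : ℝ) := by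
    rw [← Real.rpow_add hρ'0]; norm_num
  -- `E.K ≤ ρ'^{3/4} ν`, hence `K/ν ≤ ρ'^{3/4}`
  have hKν : K / ν ≤ ρ' ^ (3 / 4 : ℝ) := by
    have h1 : E.K * ρ' ^ (1 / 4 : ℝ) ≤ (ρ' ^ (1 / 4 : ℝ) * ρ' ^ (3 / 4 : ℝ)) * ν := by rw [← hsplit]; exact hT3
    have h2 : E.K ≤ ρ' ^ (3 / 4 : ℝ) * ν := by
      have : E.K * ρ' ^ (1 / 4 : ℝ) ≤ (ρ' ^ (3 / 4 : ℝ) * ν) * ρ' ^ (1 / 4 : ℝ) := by linarith [h1]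
      exact le_of_mul_le_mul_right this hq0
    rw [div_le_iff₀ hν]
    exact hKE.trans h2
  have hceil : (⌈K / ν⌉₊ : ℝ) ≤ ρ' ^ (3 / 4 : ℝ) + 1 :=
    ((Nat.ceil_lt_add_one (div_nonneg hK0 hν.le)).le).trans (by linarith)
  -- `ρ'^{3/4} + 1 ≤ ρ'`
  have h34 : ρ' ^ (3 / 4 : ℝ) * 2 ≤ ρ' := by
    calc ρ' ^ (3 / 4 : ℝ) * 2 ≤ ρ' ^ (3 / 4 : ℝ) * ρ' ^ (1 / 4 : ℝ) :=
          mul_le_mul_of_nonneg_left hq2 (Real.rpow_nonneg hρ'0.le _)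
      _ = ρ' := by rw [mul_comm, ← hsplit]
  have hsum : ρ' ^ (3 / 4 : ℝ) + 1 ≤ ρ' := by linarith
  have hρ'N : ρ' ≤ E.N (m + 1) := by
    rw [hρ'_def, div_le_iff₀ hNm]
    nlinarith
  refine ⟨hceil.trans (hsum.trans hρ'N), ?_⟩
  -- `⌈K/ν⌉/n ≤ (ρ'^{3/4} + 1)/ρ' = ρ^{1/4} + ρ ≤ 2ρ^{1/4}`
  have hρ1 : ρ ≤ 1 := by linarith
  have h34ne : ρ' ^ (3 / 4 : ℝ) ≠ 0 := (Real.rpow_pos_of_pos hρ'0 _).ne'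
  have hinv4 : (ρ' ^ (3 / 4 : ℝ)) / ρ' = ρ ^ (1 / 4 : ℝ) := by
    calc (ρ' ^ (3 / 4 : ℝ)) / ρ' = ρ' ^ (3 / 4 : ℝ) / (ρ' ^ (1 / 4 : ℝ) * ρ' ^ (3 / 4 : ℝ)) := by rw [← hsplit]
      _ = (ρ' ^ (1 / 4 : ℝ))⁻¹ := by field_simp
      _ = (ρ'⁻¹) ^ (1 / 4 : ℝ) := by rw [Real.inv_rpow hρ'0.le]
      _ = ρ ^ (1 / 4 : ℝ) := by rw [hρρ', inv_inv]
  have hρle : ρ ≤ ρ ^ (1 / 4 : ℝ) := by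
    have := Real.rpow_le_rpow_of_exponent_ge hρ0 hρ1 (by norm_num : (1 / 4 : ℝ) ≤ 1)
    rwa [Real.rpow_one] at this
  calc (⌈K / ν⌉₊ : ℝ) / E.N (m + 1) ≤ (ρ' ^ (3 / 4 : ℝ) + 1) / E.N (m + 1) := div_le_div_of_nonneg_right hceil hN.le
    _ ≤ (ρ' ^ (3 / 4 : ℝ) + 1) / ρ' := div_le_div_of_nonneg_left (by positivity) hρ'0 hρ'N
    _ = (ρ' ^ (3 / 4 : ℝ)) / ρ' + 1 / ρ' := by rw [add_div]
    _ = ρ ^ (1 / 4 : ℝ) + ρ := by rw [hinv4, hρρ', div_inv_eq_mul, one_mul]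
    _ ≤ 2 * ρ ^ (1 / 4 : ℝ) := by linarith

/-- (T4) ⇒ `θ(m+1) ≤ θ₀·ρ^{1/16}` and `θ(m+1) ≤ θ₀`. -/
theorem theta_facts (E : LagrangianLatticeCarrier k) (m : ℕ) {θ₀ : ℝ} (hN2 : E.N m ^ 2 ≤ E.N (m + 1))
    (hT4 : E.θ (m + 1) * ((E.N (m + 1) : ℝ) / E.N m) ^ (1 / 16 : ℝ) ≤ θ₀) :
    E.θ (m + 1) ≤ θ₀ * ((E.N m : ℝ) / E.N (m + 1)) ^ (1 / 16 : ℝ) ∧ E.θ (m + 1) ≤ θ₀ := by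
  set ρ : ℝ := (E.N m : ℝ) / E.N (m + 1) with hρ_def
  have hN : (0:ℝ) < E.N (m + 1) := by exact_mod_cast E.N_pos (m + 1)
  have hNm : (0:ℝ) < E.N m := by exact_mod_cast E.N_pos m
  have hρ0 : 0 < ρ := div_pos hNm hN
  have hρ1 : ρ ≤ 1 := OneLevelSplit.rho_le_one hN2
  have hθ : 0 < E.θ (m + 1) := E.θ_pos (m + 1)
  have e : ((E.N (m + 1) : ℝ) / E.N m) = ρ⁻¹ := by rw [hρ_def, inv_div]
  rw [e, Real.inv_rpow hρ0.le] at hT4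
  have hpos : 0 < ρ ^ (1 / 16 : ℝ) := Real.rpow_pos_of_pos hρ0 _
  have h1 : E.θ (m + 1) ≤ θ₀ * ρ ^ (1 / 16 : ℝ) := by
    calc E.θ (m + 1) = E.θ (m + 1) * (ρ ^ (1 / 16 : ℝ))⁻¹ * ρ ^ (1 / 16 : ℝ) := by field_simp
      _ ≤ θ₀ * ρ ^ (1 / 16 : ℝ) := mul_le_mul_of_nonneg_right hT4 hpos.le
  have hρ16 : ρ ^ (1 / 16 : ℝ) ≤ 1 := Real.rpow_le_one hρ0.le hρ1 (by norm_num)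
  have hθ₀ : 0 ≤ θ₀ := le_trans (by positivity) hT4
  exact ⟨h1, h1.trans (by nlinarith)⟩

/-- (T5) + `physPeriod_eq` ⇒ the cell period over a cell window is the physical ratio, and `physPeriod ≤ ρ^{1/16}·R`. -/
theorem period_facts (E : LagrangianLatticeCarrier k) (m : ℕ) {W : LatticeWord k} {M : ℝ} {hM : 0 < M} (hdes : E.design = W.stretch M hM)
    (hT5 : ((E.N (m + 1) : ℝ) / E.N m) ^ (1 / 16 : ℝ) * E.physPeriod (m + 1) ≤ E.refresh (m + 1)) (τ : ℝ) :
    (M * W.period / E.cellVisc (m + 1)) / (E.a (m + 1) * τ) = E.physPeriod (m + 1) / τ ∧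
      E.physPeriod (m + 1) ≤ ((E.N m : ℝ) / E.N (m + 1)) ^ (1 / 16 : ℝ) * E.refresh (m + 1) ∧ 0 < E.physPeriod (m + 1) := by
  set ρ : ℝ := (E.N m : ℝ) / E.N (m + 1) with hρ_def
  have hN : (0:ℝ) < E.N (m + 1) := by exact_mod_cast E.N_pos (m + 1)
  have hNm : (0:ℝ) < E.N m := by exact_mod_cast E.N_pos m
  have hρ0 : 0 < ρ := div_pos hNm hN
  have hν : 0 < E.cellVisc (m + 1) := cellVisc_pos' E.toFractalCarrierData (m + 1)
  have ha : 0 < E.a (m + 1) := E.a_pos (m + 1)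
  have hP : E.physPeriod (m + 1) = M * W.period / (E.cellVisc (m + 1) * E.a (m + 1)) := by
    rw [show E.physPeriod (m + 1) = E.toFractalCarrierData.physPeriod (m + 1) from rfl, physPeriod_eq E.toFractalCarrierData hdes (m + 1)]
  have hWp : 0 < W.period := PermissibleCarrier.period_pos W
  refine ⟨?_, ?_, by rw [hP]; positivity⟩
  · rw [hP]
    rcases eq_or_ne τ 0 with hτ | hτ
    · rw [hτ]; simp
    · field_simp
  · have e : ((E.N (m + 1) : ℝ) / E.N m) = ρ⁻¹ := by rw [hρ_def, inv_div]
    rw [e, Real.inv_rpow hρ0.le] at hT5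
    have hpos : 0 < ρ ^ (1 / 16 : ℝ) := Real.rpow_pos_of_pos hρ0 _
    calc E.physPeriod (m + 1) = ρ ^ (1 / 16 : ℝ) * ((ρ ^ (1 / 16 : ℝ))⁻¹ * E.physPeriod (m + 1)) := by field_simp
      _ ≤ ρ ^ (1 / 16 : ℝ) * E.refresh (m + 1) := mul_le_mul_of_nonneg_left hT5 hpos.le

end Summit.AnomalousDissipation.AnomalousDissipation.Theorems.SolenoidalFractalHomogenisation.LagrangianStep.Z7Glue

end
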